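import Literature.Barriers.SmoothPoincare4.LowGenusTrisectionsStandard
import Literature.Topology.FourManifolds.SPC4Wave0
import Literature.Topology.FourManifolds.TrisectionEulerProofs
import HarnessLib

/-!
# Barrier (SmoothPoincare4): low-genus trisections carry no exotic 4-sphere — proofs companion

Sibling of `Literature/Barriers/SmoothPoincare4/LowGenusTrisectionsStandard.lean` (theorems only;
no definition, no named fact).

The barrier file renders the technique class "an exotic 4-sphere with a Gay–Kirby trisection of
genus `≤ g₀`" as `Literature.Barriers.SmoothPoincare4.ExoticTrisectedSphereOfGenusLE g₀`, vendors
the homotopy-sphere corollaries of Meier–Zupan 2017 (arXiv Thm. 1.3) and Meier–Schirmer–Zupan 2016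
(arXiv Thm. 1.2) as the named facts `mz_genus_le_two_homotopySphere_gk` and `msz_homotopySphere_gk`,
and proves the barriers `LowGenusTrisectionBarrier := ¬ ExoticTrisectedSphereOfGenusLE 2` and
`LargeKTrisectionBarrier` from them (`lowGenusTrisectionBarrier_of_mz`,
`largeKTrisectionBarrier_of_msz`), and `LowGenusTrisectionBarrier` also from `msz_homotopySphere_gk`
together with the Euler-characteristic fact
`Literature.Topology.FourManifolds.gkTrisection_genus_eq_sum_of_homotopyEquiv_sphere`
(`lowGenusTrisectionBarrier_of_msz`).  Here the relations are closed up: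

* `exoticTrisectedSphereOfGenusLE_two_iff_not_mz`, `lowGenusTrisectionBarrier_iff_mz`,
  `largeKTrisectionBarrier_iff_msz`: each barrier statement is *equivalent* to the named fact it
  is proved from (at universe `0`).  So an unconditional `LowGenusTrisectionBarrier_holds` is
  exactly a formal proof of the Meier–Zupan homotopy-sphere corollary over `IsGKTrisection`, and
  the two barrier `def`s carry no trust beyond the facts.
* `lowGenusTrisectionBarrier_of_largeK`: given the Euler-characteristic fact, the genus-`≤ 2`
  barrier follows from the large-`k` barrier; with the equivalences, the independent inputs of
  the whole barrier file are exactly {`msz_homotopySphere_gk`,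
  `gkTrisection_genus_eq_sum_of_homotopyEquiv_sphere`}.
* `three_le_of_exoticTrisectedSphereOfGenusLE`: given those two inputs the graded class is empty
  below genus `3` (graded form of `exotic_trisection_constraints`).
* `not_exoticTrisectedSphereOfGenusLE_of_smoothPoincare` (and the `mz`/`msz`/barrier corollaries):
  the barrier, and both facts at universe `0`, are implied by the conjecture the barrier bounds
  (the literal body of `SmoothPoincare4`, Mathlib's
  `ContinuousMap.HomotopyEquiv.NonemptyDiffeomorphSphere M 4` for all Hausdorff second countable
  `M : Type`).
* `ExoticTrisectedSphereOfGenusLE.not_smoothPoincare`,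
  `ExoticTrisectedSphereOfGenusLE.existsExoticFourSphere`: an inhabitant of the technique class
  refutes `SmoothPoincare4` (unconditionally) and, through Freedman's theorem
  `Literature.Topology.FourManifolds.nonempty_homeomorph_sphere_four`, yields the flag
  `Literature.Topology.FourManifolds.ExistsExoticFourSphere` — the `blocks:` line made formal;
  `exists_exoticTrisectedSphereOfGenusLE_iff_not_smoothPoincare`: given Gay–Kirby existence
  (`Literature.Topology.FourManifolds.exists_isBalancedGKTrisection`) the graded family EXHAUSTS
  the refutations of `SmoothPoincare4`: `(∃ g₀, ExoticTrisectedSphereOfGenusLE g₀) ↔ ¬ SPC4`.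

## Why the facts are not discharged here (triage `XL`)

`msz_homotopySphere_gk` is the homotopy-sphere case of MSZ Thm. 1.2, whose printed proof passes
through Heegaard–Kirby diagrams (MSZ §4), Waldhausen's theorem on Heegaard splittings of
`#ᵏ(S¹ × S²)`, Laudenbach–Poénaru, and "deep classification results for Dehn surgeries between
connected sums of `S¹ × S²`" (Gabai, Gordon, Scharlemann; MSZ p. 3); the Euler-characteristic fact
needs the handle decomposition induced by a trisection (GK Remark 2, MSZ Remark 3.12 and §4), the
Euler characteristic of a compact manifold and its homotopy invariance.  None of this exists in
Mathlib or the tree, and under the fact discipline (D-0026) no further named fact is minted: the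
trust base stays {`msz_homotopySphere_gk`, `gkTrisection_genus_eq_sum_of_homotopyEquiv_sphere`}
(or {`mz_genus_le_two_homotopySphere_gk`} for the genus-`≤ 2` barrier alone).  When both inputs
are discharged, `LowGenusTrisectionBarrier_holds` is the one-liner
`lowGenusTrisectionBarrier_of_msz hχ hMSZ`.

## References

[MeierZupan2017] arXiv:1410.8133, Thm. 1.3 (journal Thm. 1.2) and §1 · [MeierSchirmerZupan2016]
arXiv:1507.06561, Thm. 1.2, Conjecture 3.11, Remark 3.12 · [GayKirby2016] Def. 1, Remark 2, Thm 4 ·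
[Freedman1982] Thm 1.6 · [FreedmanGompfMorrisonWalker2010] §1 Conjecture 1.
-/

noncomputable section

open scoped Manifold ContDiff
open ContinuousMap

namespace Literature.Barriers.SmoothPoincare4

/-! ### The barriers are exactly the facts -/

/-- **`ExoticTrisectedSphereOfGenusLE 2` holds iff the Meier–Zupan fact fails** (universe `0`).
Forward: an exotic 4-sphere with a trisection of genus `≤ 2` is a counterexample to
`mz_genus_le_two_homotopySphere_gk`.  Backward: if the fact fails, some closed connected oriented
smooth `X ≃ₕ S⁴` with a trisection of genus `≤ 2` has no diffeomorphism to `S⁴`, i.e. witnesses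
the technique class.  In particular an inhabitant of the class would be a disproof of the
Meier–Zupan / Meier–Schirmer–Zupan corollary as rendered in the tree.
[cite: MeierZupan2017, Thm. 1.2 (arXiv Thm. 1.3)] -/
theorem exoticTrisectedSphereOfGenusLE_two_iff_not_mz :
    ExoticTrisectedSphereOfGenusLE 2 ↔ ¬ mz_genus_le_two_homotopySphere_gk.{0} := by
  constructor
  · rintro ⟨X, _, _, _, _, _, _, _, o, g, k, S, hT, hg, ⟨e⟩, hE⟩ hMZ
    exact hE.false (hMZ X o g k S hT hg e).some
  · intro hMZ
    by_contra hE
    apply hMZ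
    intro X _ _ _ _ _ _ _ o g k S hT hg e
    by_contra hN
    exact hE ⟨X, inferInstance, inferInstance, inferInstance, inferInstance, inferInstance,
      inferInstance, inferInstance, o, g, k, S, hT, hg, ⟨e⟩, not_nonempty_iff.mp hN⟩

/-- **The genus-`≤ 2` barrier is equivalent to the Meier–Zupan fact**:
`LowGenusTrisectionBarrier ↔ mz_genus_le_two_homotopySphere_gk.{0}`.  Hence an unconditional
proof of the barrier is exactly a formal proof of "a closed connected oriented smooth homotopy
4-sphere with a trisection of genus `≤ 2` is diffeomorphic to `S⁴`" over `IsGKTrisection`.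
[cite: MeierZupan2017, Thm. 1.2 (arXiv Thm. 1.3)] -/
theorem lowGenusTrisectionBarrier_iff_mz :
    LowGenusTrisectionBarrier ↔ mz_genus_le_two_homotopySphere_gk.{0} := by
  unfold LowGenusTrisectionBarrier
  rw [exoticTrisectedSphereOfGenusLE_two_iff_not_mz, not_not]

/-- **The large-`k` barrier is equivalent to the Meier–Schirmer–Zupan fact**:
`LargeKTrisectionBarrier ↔ msz_homotopySphere_gk.{0}`.
[cite: MeierSchirmerZupan2016, Thm. 1.2 (arXiv numbering)] -/
theorem largeKTrisectionBarrier_iff_msz :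
    LargeKTrisectionBarrier ↔ msz_homotopySphere_gk.{0} := by
  constructor
  · intro hB X _ _ _ _ _ _ _ o g k S hT hk e
    by_contra hN
    exact hB ⟨X, inferInstance, inferInstance, inferInstance, inferInstance, inferInstance,
      inferInstance, inferInstance, o, g, k, S, hT, hk, ⟨e⟩, not_nonempty_iff.mp hN⟩
  · exact largeKTrisectionBarrier_of_msz

/-- **The genus-`≤ 2` barrier from the large-`k` barrier and the Euler characteristic.** Given
`gkTrisection_genus_eq_sum_of_homotopyEquiv_sphere` (a trisected homotopy 4-sphere has
`g = k₀ + k₁ + k₂`, so genus `≤ 2` forces some `kᵢ ≥ g − 1`), `LargeKTrisectionBarrier` implies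
`LowGenusTrisectionBarrier`; no Meier–Zupan input.
[cite: MeierSchirmerZupan2016, Thm. 1.2 and Remark 3.12] [cite: GayKirby2016, Remark 2] -/
theorem lowGenusTrisectionBarrier_of_largeK
    (hχ : Literature.Topology.FourManifolds.gkTrisection_genus_eq_sum_of_homotopyEquiv_sphere.{0})
    (h : LargeKTrisectionBarrier) : LowGenusTrisectionBarrier :=
  lowGenusTrisectionBarrier_of_msz hχ (largeKTrisectionBarrier_iff_msz.mp h)

/-- **The graded class is empty below genus `3`**, GIVEN the MSZ fact and the Euler-characteristic
fact: if `ExoticTrisectedSphereOfGenusLE g₀` is inhabited then `3 ≤ g₀` (graded form of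
`exotic_trisection_constraints`: the witnessing trisection has genus `≥ 3`).
[cite: MeierSchirmerZupan2016, Thm. 1.2 and Remark 3.12] -/
theorem three_le_of_exoticTrisectedSphereOfGenusLE
    (hχ : Literature.Topology.FourManifolds.gkTrisection_genus_eq_sum_of_homotopyEquiv_sphere.{0})
    (hMSZ : msz_homotopySphere_gk.{0}) {g₀ : ℕ} (h : ExoticTrisectedSphereOfGenusLE g₀) :
    3 ≤ g₀ := by
  obtain ⟨X, _, _, _, _, _, _, _, o, g, k, S, hT, hg, ⟨e⟩, hE⟩ := h
  exact (exotic_trisection_constraints hχ hMSZ X o hT e hE).1.trans hg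

/-! ### The barrier is implied by the conjecture it bounds -/

/-- **`SmoothPoincare4` (Mathlib form) empties every class.** If every Hausdorff second countable
smooth 4-manifold homotopy equivalent to `S⁴` is diffeomorphic to `S⁴`
(`ContinuousMap.HomotopyEquiv.NonemptyDiffeomorphSphere M 4` for all such `M : Type`, the literal
body of `Summits/SmoothPoincare4/SmoothPoincare4/Statement.lean`), then no class
`ExoticTrisectedSphereOfGenusLE g₀` is inhabited. [cite: FreedmanGompfMorrisonWalker2010, §1 Conjecture 1] -/
theorem not_exoticTrisectedSphereOfGenusLE_of_smoothPoincare
    (hS : ∀ (M : Type) [TopologicalSpace M] [T2Space M] [SecondCountableTopology M],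
      HomotopyEquiv.NonemptyDiffeomorphSphere M 4)
    (g₀ : ℕ) : ¬ ExoticTrisectedSphereOfGenusLE g₀ := by
  rintro ⟨X, _, _, _, c, i, _, _, _, _, _, _, _, _, ⟨e⟩, hE⟩
  exact hE.false (hS X c i e).some

/-- An inhabitant of the technique class **refutes `SmoothPoincare4`** (unconditionally):
contrapositive of `not_exoticTrisectedSphereOfGenusLE_of_smoothPoincare`.
[cite: FreedmanGompfMorrisonWalker2010, §1 Conjecture 1] -/
theorem ExoticTrisectedSphereOfGenusLE.not_smoothPoincare {g₀ : ℕ}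
    (h : ExoticTrisectedSphereOfGenusLE g₀) :
    ¬ ∀ (M : Type) [TopologicalSpace M] [T2Space M] [SecondCountableTopology M],
        HomotopyEquiv.NonemptyDiffeomorphSphere M 4 :=
  fun hS => not_exoticTrisectedSphereOfGenusLE_of_smoothPoincare hS g₀ h

/-- `SmoothPoincare4` (Mathlib form) implies the genus-`≤ 2` barrier. [cite: MeierZupan2017, Thm. 1.2 (arXiv Thm. 1.3)] -/
theorem lowGenusTrisectionBarrier_of_smoothPoincare
    (hS : ∀ (M : Type) [TopologicalSpace M] [T2Space M] [SecondCountableTopology M],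
      HomotopyEquiv.NonemptyDiffeomorphSphere M 4) :
    LowGenusTrisectionBarrier :=
  not_exoticTrisectedSphereOfGenusLE_of_smoothPoincare hS 2

/-- `SmoothPoincare4` (Mathlib form) implies the Meier–Zupan fact at universe `0`: the vendored
homotopy-sphere corollary is a CONSEQUENCE of the conjecture it bounds, not an independent
constraint on it. [cite: MeierZupan2017, Thm. 1.2 (arXiv Thm. 1.3)] -/
theorem mz_genus_le_two_homotopySphere_gk_of_smoothPoincare
    (hS : ∀ (M : Type) [TopologicalSpace M] [T2Space M] [SecondCountableTopology M],
      HomotopyEquiv.NonemptyDiffeomorphSphere M 4) :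
    mz_genus_le_two_homotopySphere_gk.{0} :=
  lowGenusTrisectionBarrier_iff_mz.mp (lowGenusTrisectionBarrier_of_smoothPoincare hS)

/-- `SmoothPoincare4` (Mathlib form) implies the Meier–Schirmer–Zupan fact at universe `0`, hence
the large-`k` barrier. [cite: MeierSchirmerZupan2016, Thm. 1.2 (arXiv numbering)] -/
theorem msz_homotopySphere_gk_of_smoothPoincare
    (hS : ∀ (M : Type) [TopologicalSpace M] [T2Space M] [SecondCountableTopology M],
      HomotopyEquiv.NonemptyDiffeomorphSphere M 4) :
    msz_homotopySphere_gk.{0} := by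
  intro X _ _ _ c i _ _ _ _ _ _ _ _ e
  exact hS X c i e

/-- `SmoothPoincare4` (Mathlib form) implies the large-`k` barrier. [cite: MeierSchirmerZupan2016, Thm. 1.2 (arXiv numbering)] -/
theorem largeKTrisectionBarrier_of_smoothPoincare
    (hS : ∀ (M : Type) [TopologicalSpace M] [T2Space M] [SecondCountableTopology M],
      HomotopyEquiv.NonemptyDiffeomorphSphere M 4) :
    LargeKTrisectionBarrier :=
  largeKTrisectionBarrier_of_msz (msz_homotopySphere_gk_of_smoothPoincare hS)

/-! ### An inhabitant of the technique class is an exotic 4-sphere; the graded family is exhaustive -/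

/-- **An inhabitant of the technique class is an exotic 4-sphere** (the `blocks:` line of the
barrier, formally): given Freedman's theorem in the tree's form
`Literature.Topology.FourManifolds.nonempty_homeomorph_sphere_four` (a Hausdorff second countable
topological 4-manifold `≃ₕ S⁴` is `≃ₜ S⁴`), an exotic trisected 4-sphere yields the flag
`Literature.Topology.FourManifolds.ExistsExoticFourSphere` (homeomorphic, not diffeomorphic to
`S⁴`), forgetting the trisection. [cite: Freedman1982, Thm 1.6] -/
theorem ExoticTrisectedSphereOfGenusLE.existsExoticFourSphere {g₀ : ℕ}
    (h : ExoticTrisectedSphereOfGenusLE g₀)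
    (hFr : Literature.Topology.FourManifolds.nonempty_homeomorph_sphere_four.{0}) :
    Literature.Topology.FourManifolds.ExistsExoticFourSphere := by
  obtain ⟨X, _, _, _, _, _, _, _, _, _, _, _, _, _, ⟨e⟩, hE⟩ := h
  obtain ⟨φ⟩ := hFr X e
  exact ⟨X, inferInstance, inferInstance, inferInstance, φ, hE⟩

/-- Contrapositive: if there is no exotic 4-sphere (flag form) then, given Freedman's theorem,
no class `ExoticTrisectedSphereOfGenusLE g₀` is inhabited. [cite: Freedman1982, Thm 1.6] -/
theorem not_exoticTrisectedSphereOfGenusLE_of_not_existsExoticFourSphere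
    (hFr : Literature.Topology.FourManifolds.nonempty_homeomorph_sphere_four.{0})
    (hX : ¬ Literature.Topology.FourManifolds.ExistsExoticFourSphere) (g₀ : ℕ) :
    ¬ ExoticTrisectedSphereOfGenusLE g₀ :=
  fun h => hX (h.existsExoticFourSphere hFr)

/-- **The graded family exhausts the refutations of `SmoothPoincare4`**, GIVEN Gay–Kirby's
existence theorem (`Literature.Topology.FourManifolds.exists_isBalancedGKTrisection`, hypothesis
`hGK`): some class `ExoticTrisectedSphereOfGenusLE g₀` is inhabited iff the literal body of
`SmoothPoincare4` fails.  (`←`: a counterexample `M` is a closed orientable smooth homotopy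
4-sphere, hence trisected — `exoticTrisectedSphereOfGenusLE_of_exotic`.)  With
`three_le_of_exoticTrisectedSphereOfGenusLE`: an exotic 4-sphere, if any, first appears at some
genus `g₀ ≥ 3`. [cite: GayKirby2016, Thm 4] -/
theorem exists_exoticTrisectedSphereOfGenusLE_iff_not_smoothPoincare
    (hGK : Literature.Topology.FourManifolds.exists_isBalancedGKTrisection.{0}) :
    (∃ g₀, ExoticTrisectedSphereOfGenusLE g₀) ↔
      ¬ ∀ (M : Type) [TopologicalSpace M] [T2Space M] [SecondCountableTopology M],
          HomotopyEquiv.NonemptyDiffeomorphSphere M 4 := by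
  constructor
  · rintro ⟨g₀, h⟩
    exact h.not_smoothPoincare
  · intro hS
    by_contra hne
    refine hS fun M _ _ _ c i e => ?_
    by_contra hd
    obtain ⟨g₀, h⟩ := exoticTrisectedSphereOfGenusLE_of_exotic hGK M e (not_nonempty_iff.mp hd)
    exact hne ⟨g₀, h⟩

/-- Flag form of the exhaustion: GIVEN Gay–Kirby existence and Freedman's theorem, some class
`ExoticTrisectedSphereOfGenusLE g₀` is inhabited iff an exotic 4-sphere exists
(`Literature.Topology.FourManifolds.ExistsExoticFourSphere`). [cite: GayKirby2016, Thm 4] [cite: Freedman1982, Thm 1.6] -/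
theorem exists_exoticTrisectedSphereOfGenusLE_iff_existsExoticFourSphere
    (hGK : Literature.Topology.FourManifolds.exists_isBalancedGKTrisection.{0})
    (hFr : Literature.Topology.FourManifolds.nonempty_homeomorph_sphere_four.{0}) :
    (∃ g₀, ExoticTrisectedSphereOfGenusLE g₀) ↔
      Literature.Topology.FourManifolds.ExistsExoticFourSphere := by
  rw [exists_exoticTrisectedSphereOfGenusLE_iff_not_smoothPoincare hGK,
    Literature.Topology.FourManifolds.existsExoticFourSphere_iff_not_forall_nonemptyDiffeomorphSphere_four hFr]

/-! ### Update 2026-08-15 (review of `msz_homotopySphere_gk`): the Euler-characteristic input is a theorem — the entry rests on `msz_homotopySphere_gk` alone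

The Euler-characteristic fact `Literature.Topology.FourManifolds.gkTrisection_genus_eq_sum_of_homotopyEquiv_sphere`
(a `(g; k₀, k₁, k₂)`-trisected closed oriented smooth `X ≃ₕ S⁴` has `g = k₀ + k₁ + k₂`;
Gay–Kirby 2016, Remark 2; Meier–Schirmer–Zupan 2016, Remark 3.12) is now PROVED in the tree:
`Literature.Topology.FourManifolds.gkTrisection_genus_eq_sum_of_homotopyEquiv_sphere_holds`
(`TrisectionEulerProofs.lean`, Part II: inclusion–exclusion of the rational Čech Euler
characteristic over the closed cover by the three sectors, tautness, Morse equalities).  Feeding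
it to the `_of_msz` theorems removes the hypothesis `hχ` everywhere, so that — with
`largeKTrisectionBarrier_iff_msz` and `lowGenusTrisectionBarrier_iff_mz` above — the single
unproved input of the whole barrier entry (both barrier statements, the Meier–Zupan-range fact,
the genus-`≥ 3` / `kᵢ ≤ g − 2` / `g = Σ kᵢ` constraints) is the Meier–Schirmer–Zupan fact
`msz_homotopySphere_gk`; formally `msz_homotopySphere_gk.{0} ↔ LowGenusTrisectionBarrier ∧
LargeKTrisectionBarrier` (`msz_iff_lowGenus_and_largeK`).  This supersedes the sentence "the
independent inputs of the whole barrier file are exactly {`msz_homotopySphere_gk`,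
`gkTrisection_genus_eq_sum_of_homotopyEquiv_sphere`}" of the module docstring and scope caveat (d)
of `LowGenusTrisectionBarrier`.

**Why `msz_homotopySphere_gk` is not discharged (review verdict, statement re-checked against
arXiv:1507.06561, p. 3: Def. 1.1 — symmetric in `X₁, X₂, X₃`, so "`k₁ ≥ g − 1`" is "some
`kᵢ ≥ g − 1`" — and Thm. 1.2 verbatim).**  Already its instance `g = 0` (type `(0; 0,0,0)`:
three 4-balls meeting pairwise in 3-balls, "the unique trisection of genus zero", MSZ p. 3) asserts
that every `(0; 0,0,0)`-trisected homotopy 4-sphere is diffeomorphic to `S⁴`; every twisted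
sphere `D⁴ ∪_φ D⁴` is so trisected (first disc, bevelled along the equatorial `S²` of the second,
and the two half-discs of the second), so the instance contains "every twisted 4-sphere is `S⁴`",
i.e. Cerf's `Γ₄ = 0` — the tree's unproved named fact
`Literature.Topology.FourManifolds.cerf_twistedSphere_four`, reduced in the tree to the single
leaf `Literature.Topology.FourManifolds.cerf_pi0DiffDisc_relBoundary_three` (`π₀ Diff(D³; S²) = 0`,
Cerf 1968, Ch. II–VI).  The general case uses in addition Waldhausen's theorem on Heegaard
splittings of `#ᵏ(S¹ × S²)` (MSZ Thm. 2.7), Laudenbach–Poénaru (tree fact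
`Literature.Topology.FourManifolds.exists_diffeomorph_comp_incl_eq`, which itself contains
`Γ₄ = 0`: `SPC4HandlesImpliesCerf.lean`) and the Dehn-surgery classification results of MSZ §§4–5.
No named fact is introduced here; everything below is proved.
[cite: MeierSchirmerZupan2016, Def. 1.1, Thm. 1.2, Thm. 2.7, Remark 3.12]
[cite: GayKirby2016, Remark 2] [cite: CerfDiffeoSphere1968, Ch. I §1, Corollaire 1 (Γ₄ = 0)] -/

section EulerInputProved

universe u

/-- **The Meier–Zupan-range fact from the MSZ fact alone**: `msz_homotopySphere_gk` implies
`mz_genus_le_two_homotopySphere_gk` (a genus-`≤ 2` trisection of a homotopy 4-sphere has some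
`kᵢ ≥ g − 1` by the proved `g = k₀ + k₁ + k₂`).
[cite: MeierSchirmerZupan2016, Thm. 1.2 and Remark 3.12] [cite: GayKirby2016, Remark 2] -/
theorem mz_genus_le_two_homotopySphere_gk_of_msz_alone (hMSZ : msz_homotopySphere_gk.{u}) :
    mz_genus_le_two_homotopySphere_gk.{u} :=
  mz_genus_le_two_homotopySphere_gk_of_msz
    Literature.Topology.FourManifolds.gkTrisection_genus_eq_sum_of_homotopyEquiv_sphere_holds hMSZ

/-- **`LowGenusTrisectionBarrier` from the MSZ fact alone** (no Meier–Zupan input, no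
Euler-characteristic hypothesis): no exotic 4-sphere has a trisection of genus `≤ 2`, GIVEN
`msz_homotopySphere_gk`. [cite: MeierSchirmerZupan2016, Thm. 1.2 and Remark 3.12] -/
theorem lowGenusTrisectionBarrier_of_msz_alone (hMSZ : msz_homotopySphere_gk.{0}) :
    LowGenusTrisectionBarrier :=
  lowGenusTrisectionBarrier_of_msz
    Literature.Topology.FourManifolds.gkTrisection_genus_eq_sum_of_homotopyEquiv_sphere_holds hMSZ

/-- Monotone form: GIVEN `msz_homotopySphere_gk`, no class `ExoticTrisectedSphereOfGenusLE g₀`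
with `g₀ ≤ 2` is inhabited. [cite: MeierSchirmerZupan2016, Thm. 1.2 and Remark 3.12] -/
theorem not_exoticTrisectedSphereOfGenusLE_of_le_two_of_msz_alone (hMSZ : msz_homotopySphere_gk.{0})
    {g₀ : ℕ} (h : g₀ ≤ 2) : ¬ ExoticTrisectedSphereOfGenusLE g₀ :=
  not_exoticTrisectedSphereOfGenusLE_of_le_two_of_msz
    Literature.Topology.FourManifolds.gkTrisection_genus_eq_sum_of_homotopyEquiv_sphere_holds hMSZ h

/-- **The large-`k` barrier implies the genus-`≤ 2` barrier**, unconditionally (the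
Euler-characteristic input being proved). [cite: MeierSchirmerZupan2016, Thm. 1.2 and Remark 3.12] -/
theorem lowGenusTrisectionBarrier_of_largeKTrisectionBarrier (h : LargeKTrisectionBarrier) :
    LowGenusTrisectionBarrier :=
  lowGenusTrisectionBarrier_of_largeK
    Literature.Topology.FourManifolds.gkTrisection_genus_eq_sum_of_homotopyEquiv_sphere_holds h

/-- **The whole entry is exactly the MSZ fact**: `msz_homotopySphere_gk` (universe `0`) is
equivalent to the conjunction of the two barrier statements `LowGenusTrisectionBarrier` and
`LargeKTrisectionBarrier` — the second is equivalent to it (`largeKTrisectionBarrier_iff_msz`)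
and implies the first (`lowGenusTrisectionBarrier_of_largeKTrisectionBarrier`).  So the trust
base of this barrier entry is the single named fact `msz_homotopySphere_gk`.
[cite: MeierSchirmerZupan2016, Thm. 1.2 (arXiv numbering)] -/
theorem msz_iff_lowGenus_and_largeK :
    msz_homotopySphere_gk.{0} ↔ LowGenusTrisectionBarrier ∧ LargeKTrisectionBarrier := by
  constructor
  · intro h
    exact ⟨lowGenusTrisectionBarrier_of_msz_alone h, largeKTrisectionBarrier_of_msz h⟩
  · intro h
    exact largeKTrisectionBarrier_iff_msz.mp h.2

/-- **Constraints on a trisection of an exotic 4-sphere, GIVEN the MSZ fact alone**: genus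
`g ≥ 3`, every `kᵢ ≤ g − 2`, and `g = k₀ + k₁ + k₂` (the last conjunct unconditionally, by the
proved Euler-characteristic fact); the possible types begin `(3; 1,1,1)`, `(4; 2,1,1)`,
`(4; 2,2,0)` up to relabelling. [cite: MeierSchirmerZupan2016, Thm. 1.2 and Remark 3.12] [cite: GayKirby2016, Remark 2] -/
theorem exotic_trisection_constraints_of_msz_alone (hMSZ : msz_homotopySphere_gk.{u})
    (X : Type u) [TopologicalSpace X] [T2Space X] [SecondCountableTopology X]
    [ChartedSpace (EuclideanSpace ℝ (Fin 4)) X] [IsManifold (𝓡 4) ∞ X] [CompactSpace X]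
    [ConnectedSpace X] (o : Literature.Topology.FourManifolds.SmoothOrientation (𝓡 4) X)
    {g : ℕ} {k : Fin 3 → ℕ} {S : Fin 3 → Set X}
    (hT : Literature.Topology.FourManifolds.IsGKTrisection X g k S)
    (e : X ≃ₕ (Metric.sphere (0 : EuclideanSpace ℝ (Fin 5)) 1))
    (hE : IsEmpty (X ≃ₘ⟮𝓡 4, 𝓡 4⟯ (Metric.sphere (0 : EuclideanSpace ℝ (Fin 5)) 1))) :
    3 ≤ g ∧ (∀ i, k i + 2 ≤ g) ∧ g = k 0 + k 1 + k 2 :=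
  exotic_trisection_constraints
    Literature.Topology.FourManifolds.gkTrisection_genus_eq_sum_of_homotopyEquiv_sphere_holds hMSZ X o hT e hE

/-- **Unconditionally**, every trisection (with corners) of a closed oriented smooth homotopy
4-sphere — exotic or not — has `g = k₀ + k₁ + k₂`: the proved Euler-characteristic fact, restated
in this entry's context for the graded technique class (a witness of
`ExoticTrisectedSphereOfGenusLE g₀` is trisected with `g = Σ kᵢ ≤ g₀`).
[cite: GayKirby2016, Remark 2] [cite: MeierSchirmerZupan2016, Remark 3.12] -/
theorem ExoticTrisectedSphereOfGenusLE.exists_genus_eq_sum {g₀ : ℕ}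
    (h : ExoticTrisectedSphereOfGenusLE g₀) :
    ∃ (X : Type) (_ : TopologicalSpace X) (_ : T2Space X) (_ : SecondCountableTopology X)
      (_ : ChartedSpace (EuclideanSpace ℝ (Fin 4)) X) (_ : IsManifold (𝓡 4) ∞ X) (_ : CompactSpace X)
      (_ : ConnectedSpace X) (_ : Literature.Topology.FourManifolds.SmoothOrientation (𝓡 4) X)
      (g : ℕ) (k : Fin 3 → ℕ) (S : Fin 3 → Set X),
      Literature.Topology.FourManifolds.IsGKTrisection X g k S ∧ g = k 0 + k 1 + k 2 ∧ g ≤ g₀ ∧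
        Nonempty (X ≃ₕ (Metric.sphere (0 : EuclideanSpace ℝ (Fin 5)) 1)) ∧
        IsEmpty (X ≃ₘ⟮𝓡 4, 𝓡 4⟯ (Metric.sphere (0 : EuclideanSpace ℝ (Fin 5)) 1)) := by
  obtain ⟨X, _, _, _, _, _, _, _, o, g, k, S, hT, hg, ⟨e⟩, hE⟩ := h
  exact ⟨X, inferInstance, inferInstance, inferInstance, inferInstance, inferInstance,
    inferInstance, inferInstance, o, g, k, S, hT,
    Literature.Topology.FourManifolds.gkTrisection_genus_eq_sum_of_homotopyEquiv_sphere_holds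
      X o g k S hT e, hg, ⟨e⟩, hE⟩

/-- **The graded class is empty below genus `3`, GIVEN the MSZ fact alone.**
[cite: MeierSchirmerZupan2016, Thm. 1.2 and Remark 3.12] -/
theorem three_le_of_exoticTrisectedSphereOfGenusLE_of_msz_alone (hMSZ : msz_homotopySphere_gk.{0})
    {g₀ : ℕ} (h : ExoticTrisectedSphereOfGenusLE g₀) : 3 ≤ g₀ :=
  three_le_of_exoticTrisectedSphereOfGenusLE
    Literature.Topology.FourManifolds.gkTrisection_genus_eq_sum_of_homotopyEquiv_sphere_holds hMSZ h

/-- **A genus-`3` trisection of an exotic 4-sphere is of type `(3; 1,1,1)`, GIVEN the MSZ fact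
alone** — the first type not decided by the catalogued results.
[cite: MeierSchirmerZupan2016, Thm. 1.2 and Remark 3.12] -/
theorem eq_one_of_exotic_of_genus_three_of_msz_alone (hMSZ : msz_homotopySphere_gk.{u})
    (X : Type u) [TopologicalSpace X] [T2Space X] [SecondCountableTopology X]
    [ChartedSpace (EuclideanSpace ℝ (Fin 4)) X] [IsManifold (𝓡 4) ∞ X] [CompactSpace X]
    [ConnectedSpace X] (o : Literature.Topology.FourManifolds.SmoothOrientation (𝓡 4) X)
    {k : Fin 3 → ℕ} {S : Fin 3 → Set X}
    (hT : Literature.Topology.FourManifolds.IsGKTrisection X 3 k S)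
    (e : X ≃ₕ (Metric.sphere (0 : EuclideanSpace ℝ (Fin 5)) 1))
    (hE : IsEmpty (X ≃ₘ⟮𝓡 4, 𝓡 4⟯ (Metric.sphere (0 : EuclideanSpace ℝ (Fin 5)) 1))) (i : Fin 3) :
    k i = 1 :=
  eq_one_of_exotic_of_genus_three
    Literature.Topology.FourManifolds.gkTrisection_genus_eq_sum_of_homotopyEquiv_sphere_holds hMSZ X o hT e hE i

/-- `SmoothPoincare4` (Mathlib form) implies BOTH barrier statements at once (through
`msz_homotopySphere_gk_of_smoothPoincare` and `msz_iff_lowGenus_and_largeK`): the entry is a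
consequence of the conjecture it bounds. [cite: FreedmanGompfMorrisonWalker2010, §1 Conjecture 1] -/
theorem lowGenus_and_largeK_of_smoothPoincare
    (hS : ∀ (M : Type) [TopologicalSpace M] [T2Space M] [SecondCountableTopology M],
      HomotopyEquiv.NonemptyDiffeomorphSphere M 4) :
    LowGenusTrisectionBarrier ∧ LargeKTrisectionBarrier :=
  msz_iff_lowGenus_and_largeK.mp (msz_homotopySphere_gk_of_smoothPoincare hS)

end EulerInputProved

end Literature.Barriers.SmoothPoincare4

end
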